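import Summits.AtomisticToContinuum.BoseEinsteinCondensation.Theses.BECPeriodicReduction
import Summits.AtomisticToContinuum.BoseEinsteinCondensation.Theses.BECGroundStateSOS
import Summits.AtomisticToContinuum.BoseEinsteinCondensation.Theorems.BECGroundStateSOSRimSqueezeDefs
import Summits.AtomisticToContinuum.BoseEinsteinCondensation.Theorems.BECGroundStateSOSBoundaryTransferWeakTorusCoreFloor
import Summits.AtomisticToContinuum.BoseEinsteinCondensation.Theorems.BECGroundStateSOSBoundaryTransferWeakTorusGapLocallyBounded
import Summits.AtomisticToContinuum.BoseEinsteinCondensation.Theorems.BECGroundStateSOSBoundaryTransferWeakHardWallLimitLocallyBounded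
import Summits.AtomisticToContinuum.BoseEinsteinCondensation.Theorems.BECGroundStateSOSBoundaryTransferWeakDirichletEndpoint

/-!
# Line `rim-squeeze-monotone-coherence` (crux stmt-AtomisticToContinuum-0827 `BoundaryTransferWeak`) —
# lead c4 AUDIT of the open stub (M): the weakest form the composition consumes, and what it implies

Kernel-checked bookkeeping behind the lead-c4 dossier `Lines/rim_squeeze_monotone_coherence.dead.md`.

* `CoreFloorAlongRamp v` (M_A) — the WEAKEST statement about the ramp that the composition can use in
  place of (G) ∧ (T) ∧ (M): given torus BEC `A(v)`, the core flat-mode occupation of the ground states of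
  `H_t = H^per + t Σ 1_rim` has a macroscopic floor `c₁ N` for ALL finite couplings `t`, eventually in `N`,
  at every small density. `coreFloorAlongRamp_of_stubs`: (G) ∧ (T) ∧ (M) at `v` ⟹ (M_A) at `v` (so
  re-registering (M_A) instead of (M) loses nothing), and `boundaryTransferWeak_of_coreFloor`:
  (M_A) ∧ (L) ∧ (D) ⟹ the crux BY NAME (composition v4, two fixed-`N` stubs + one thermodynamic stub).
* `CoreModeTransfer v` (CMT) — "`A(v)` ⟹ the DIRICHLET cube ground states (ramp endpoint `t = ⊤`, density
  `8ρ'`) have `≥ cN` particles in the normalised indicator of the middle-half cube": the crux AT `v` with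
  the condensate MODE PINNED to an explicit interior flat mode (a strengthening of `B(v)`, which only asks
  `λ_max ≥ cN`). `coreModeTransfer_of_coreFloor`: (M_A) ∧ (L) ⟹ (CMT); `cruxAt_of_coreModeTransfer`:
  (CMT) ∧ (D) ⟹ (`A(v) → B(v)`). With the LANDED (L) (locally bounded class, p161447) and (D) (p155818):
  `cruxAt_of_coreFloorAlongRamp_locallyBounded` — for every locally bounded admissible `v` the line's one
  open thermodynamic stub implies the crux at `v` through landed fixed-`N` glue only, and on the way
  implies the mode-pinned form (CMT). This is the formal content of "the line is REDUCED TO (a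
  mode-pinned form of) ITS PARENT": STRATEGY-CENSUS rev 2 §1 shape (c′) — k_open = 1 with the open piece
  ≥ the parent.

Nothing here is a new obligation; no `sorry`; all `[folklore]`.
-/

noncomputable section

namespace Summit.AtomisticToContinuum.BoseEinsteinCondensation.RimSqueeze.Audit

open Literature.MathematicalPhysics.QuantumManyBody.BoseGas
open MeasureTheory Filter Set
open scoped ENNReal NNReal

variable {v : ℝ → ℝ≥0∞}

/-! ## The two sides of the crux at one potential -/

/-- Torus BEC at `(v, ρ)` with constant `c` (inner body of the crux's hypothesis, verbatim). [folklore] -/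
def TorusBECAt (v : ℝ → ℝ≥0∞) (ρ c : ℝ) : Prop :=
  ∀ᶠ N : ℕ in atTop, ∃ δ : ℝ≥0∞, 0 < δ ∧
    ∀ Ψ : PeriodicTrialState N (sideLength ρ N),
      periodicEnergy v Ψ ≤ periodicGroundStateEnergy v N (sideLength ρ N) + δ →
        ENNReal.ofReal (c * N) ≤ condensateOccupation N (sideLength ρ N) Ψ.ψ

/-- `A(v)`: torus ground-state BEC at all small densities. [folklore] -/
def Antecedent (v : ℝ → ℝ≥0∞) : Prop :=
  ∃ ρ₀ : ℝ, 0 < ρ₀ ∧ ∀ ρ : ℝ, 0 < ρ → ρ < ρ₀ → ∃ c : ℝ, 0 < c ∧ TorusBECAt v ρ c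

/-- `B(v)`: Dirichlet ground-state BEC at all small densities (the conjunct's body at `v`). [folklore] -/
def Consequent (v : ℝ → ℝ≥0∞) : Prop :=
  ∃ ρ₀ : ℝ, 0 < ρ₀ ∧ ∀ ρ : ℝ, 0 < ρ → ρ < ρ₀ → HasGroundStateBEC v ρ

/-- The crux is literally `∀ v admissible, A(v) → B(v)` (registered decl, route `BECPeriodicReduction`). [folklore] -/
theorem crux_iff :
    Summit.AtomisticToContinuum.BoseEinsteinCondensation.Theses.BECPeriodicReduction.BoundaryTransferWeak ↔
      ∀ v : ℝ → ℝ≥0∞, IsRepulsiveFiniteRange v → Antecedent v → Consequent v :=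
  Iff.rfl

/-- The `BECGroundStateSOS` copy is the same term. [folklore] -/
theorem crux_iff_groundStateSOS :
    Summit.AtomisticToContinuum.BoseEinsteinCondensation.Theses.BECGroundStateSOS.BoundaryTransferWeak ↔
      ∀ v : ℝ → ℝ≥0∞, IsRepulsiveFiniteRange v → Antecedent v → Consequent v :=
  Iff.rfl

/-! ## The stub shapes of skeleton v3 at one potential -/

/-- (G) at `v`: torus Ky Fan gap eventually, at small density. [folklore] -/
def GapAt (v : ℝ → ℝ≥0∞) : Prop :=
  ∃ ρ₁ : ℝ, 0 < ρ₁ ∧ ∀ ρ' : ℝ, 0 < ρ' → ρ' < ρ₁ → ∀ᶠ N : ℕ in atTop,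
    2 * periodicGroundStateEnergy v N (sideLength ρ' N) < kyFanTwo v N (sideLength ρ' N)

/-- (T) at `v`: gap + torus BEC criterion at `N` ⟹ core floor `(c/128)N` at `t = 0` (LANDED p156370). [folklore] -/
def FloorAt (v : ℝ → ℝ≥0∞) : Prop :=
  ∀ ρ' : ℝ, 0 < ρ' → ∀ c : ℝ, 0 < c → ∀ N : ℕ,
    2 * periodicGroundStateEnergy v N (sideLength ρ' N) < kyFanTwo v N (sideLength ρ' N) →
    (∃ δ : ℝ≥0∞, 0 < δ ∧ ∀ Ψ : PeriodicTrialState N (sideLength ρ' N),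
        periodicEnergy v Ψ ≤ periodicGroundStateEnergy v N (sideLength ρ' N) + δ →
          ENNReal.ofReal (c * N) ≤ condensateOccupation N (sideLength ρ' N) Ψ.ψ) →
    ENNReal.ofReal (c / 128 * N) ≤ coreOcc v 0 N ρ'

/-- (M) at `v`: rim monotonicity with `εN` slack, all finite `t` (the registered open stub). [folklore] -/
def MonotoneAt (v : ℝ → ℝ≥0∞) : Prop :=
  ∃ ρ₁ : ℝ, 0 < ρ₁ ∧ ∀ ρ' : ℝ, 0 < ρ' → ρ' < ρ₁ → ∀ ε : ℝ, 0 < ε → ∀ᶠ N : ℕ in atTop, ∀ t : ℝ≥0,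
    coreOcc v 0 N ρ' ≤ coreOcc v (t : ℝ≥0∞) N ρ' + ENNReal.ofReal (ε * N)

/-- (L) at `v`: fixed-`N` hard-wall limit `limsup_t coreOcc(t) ≤ coreOcc(⊤)` (LANDED for locally bounded `v`, p161447). [folklore] -/
def HardWallAt (v : ℝ → ℝ≥0∞) : Prop :=
  ∃ ρ₁ : ℝ, 0 < ρ₁ ∧ ∀ ρ' : ℝ, 0 < ρ' → ρ' < ρ₁ → ∀ᶠ N : ℕ in atTop, ∀ η : ℝ, 0 < η →
    ∃ t₀ : ℝ≥0, ∀ t : ℝ≥0, t₀ ≤ t → coreOcc v (t : ℝ≥0∞) N ρ' ≤ coreOcc v ⊤ N ρ' + ENNReal.ofReal η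

/-- (D) at `v`: the Dirichlet endpoint cashes a core floor at `t = ⊤` as `HasGroundStateBEC v (8ρ')` (LANDED p155818). [folklore] -/
def EndpointAt (v : ℝ → ℝ≥0∞) : Prop :=
  ∀ ρ' : ℝ, 0 < ρ' → (∃ c : ℝ, 0 < c ∧ ∀ᶠ N : ℕ in atTop, ENNReal.ofReal (c * N) ≤ coreOcc v ⊤ N ρ') →
    HasGroundStateBEC v (8 * ρ')

/-! ## The weakest consumable form of the open content, and the mode-pinned crux it implies -/

/-- **(M_A) — core floor along the ramp, given torus BEC.** [folklore] -/
def CoreFloorAlongRamp (v : ℝ → ℝ≥0∞) : Prop :=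
  Antecedent v → ∃ ρ₁ : ℝ, 0 < ρ₁ ∧ ∀ ρ' : ℝ, 0 < ρ' → ρ' < ρ₁ → ∃ c₁ : ℝ, 0 < c₁ ∧
    ∀ᶠ N : ℕ in atTop, ∀ t : ℝ≥0, ENNReal.ofReal (c₁ * N) ≤ coreOcc v (t : ℝ≥0∞) N ρ'

/-- **(CMT) — core-mode transfer**: torus BEC ⟹ a macroscopic floor of the CORE FLAT MODE occupation of
the Dirichlet cube ground states (the `t = ⊤` end of the ramp), at all small densities: the crux at `v`
with the condensate mode pinned. [folklore] -/
def CoreModeTransfer (v : ℝ → ℝ≥0∞) : Prop :=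
  Antecedent v → ∃ ρ₁ : ℝ, 0 < ρ₁ ∧ ∀ ρ' : ℝ, 0 < ρ' → ρ' < ρ₁ → ∃ c : ℝ, 0 < c ∧
    ∀ᶠ N : ℕ in atTop, ENNReal.ofReal (c * N) ≤ coreOcc v ⊤ N ρ'

/-- Halving bookkeeping in `ℝ≥0∞`: `ofReal (c N) = ofReal (c/2 · N) + ofReal (c/2 · N)` for `c ≥ 0`. [folklore] -/
theorem ofReal_halves {c : ℝ} (hc : 0 ≤ c) (N : ℕ) :
    ENNReal.ofReal (c * N) = ENNReal.ofReal (c / 2 * N) + ENNReal.ofReal (c / 2 * N) := by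
  rw [← ENNReal.ofReal_add (by positivity) (by positivity)]
  congr 1
  ring

/-- **(G) ∧ (T) ∧ (M) ⟹ (M_A)** at one potential: the registered trio is at least as strong as the
A-conditional floor, so re-typing the open content as (M_A) loses nothing the composition had. [folklore] -/
theorem coreFloorAlongRamp_of_stubs (hv : IsRepulsiveFiniteRange v) (hG : GapAt v) (hT : FloorAt v)
    (hM : MonotoneAt v) : CoreFloorAlongRamp v := by
  have _ := hv
  rintro ⟨ρA, hρA, hA⟩
  obtain ⟨ρG, hρG, hG'⟩ := hG
  obtain ⟨ρM, hρM, hM'⟩ := hM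
  refine ⟨min ρA (min ρG ρM), lt_min hρA (lt_min hρG hρM), fun ρ' hρ' hlt => ?_⟩
  have hA' := hA ρ' hρ' (hlt.trans_le (min_le_left _ _))
  obtain ⟨c, hc, hcrit⟩ := hA'
  have hgap := hG' ρ' hρ' (hlt.trans_le ((min_le_right _ _).trans (min_le_left _ _)))
  have hmon := hM' ρ' hρ' (hlt.trans_le ((min_le_right _ _).trans (min_le_right _ _))) (c / 256)
    (by positivity)
  refine ⟨c / 256, by positivity, ?_⟩
  filter_upwards [hgap, hcrit, hmon] with N hNg hNc hNm t
  have hfloor : ENNReal.ofReal (c / 128 * N) ≤ coreOcc v 0 N ρ' := hT ρ' hρ' c hc N hNg hNc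
  have step : ENNReal.ofReal (c / 128 * N) ≤ coreOcc v (t : ℝ≥0∞) N ρ' + ENNReal.ofReal (c / 256 * N) :=
    hfloor.trans (hNm t)
  have e : ENNReal.ofReal (c / 128 * N) =
      ENNReal.ofReal (c / 256 * N) + ENNReal.ofReal (c / 256 * N) := by
    rw [← ENNReal.ofReal_add (by positivity) (by positivity)]
    congr 1
    ring
  rw [e] at step
  exact (ENNReal.add_le_add_iff_right (by finiteness)).1 step

/-- **(M_A) ∧ (L) ⟹ (CMT)** at one potential: the floor survives the fixed-`N` hard-wall limit with
half its constant. [folklore] -/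
theorem coreModeTransfer_of_coreFloor (hF : CoreFloorAlongRamp v) (hL : HardWallAt v) :
    CoreModeTransfer v := by
  intro hA
  obtain ⟨ρF, hρF, hF'⟩ := hF hA
  obtain ⟨ρL, hρL, hL'⟩ := hL
  refine ⟨min ρF ρL, lt_min hρF hρL, fun ρ' hρ' hlt => ?_⟩
  obtain ⟨c₁, hc₁, hfl⟩ := hF' ρ' hρ' (hlt.trans_le (min_le_left _ _))
  have hlim := hL' ρ' hρ' (hlt.trans_le (min_le_right _ _))
  refine ⟨c₁ / 2, by positivity, ?_⟩
  filter_upwards [hfl, hlim, eventually_gt_atTop 0] with N hNf hNl hN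
  have hNr : (0 : ℝ) < N := Nat.cast_pos.2 hN
  obtain ⟨t₀, ht₀⟩ := hNl (c₁ / 2 * N) (by positivity)
  have chain : ENNReal.ofReal (c₁ * N) ≤ coreOcc v ⊤ N ρ' + ENNReal.ofReal (c₁ / 2 * N) :=
    (hNf t₀).trans (ht₀ t₀ le_rfl)
  rw [ofReal_halves hc₁.le] at chain
  exact (ENNReal.add_le_add_iff_right (by finiteness)).1 chain

/-- **(CMT) ∧ (D) ⟹ the crux at `v`** (run the endpoint at `ρ' = ρ/8`). [folklore] -/
theorem cruxAt_of_coreModeTransfer (hC : CoreModeTransfer v) (hD : EndpointAt v) :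
    Antecedent v → Consequent v := by
  intro hA
  obtain ⟨ρ₁, hρ₁, hC'⟩ := hC hA
  refine ⟨8 * ρ₁, by positivity, fun ρ hρ hρlt => ?_⟩
  have hρ' : 0 < ρ / 8 := by positivity
  have h8 : HasGroundStateBEC v (8 * (ρ / 8)) := hD (ρ / 8) hρ' (hC' (ρ / 8) hρ' (by linarith))
  have e : (8 : ℝ) * (ρ / 8) = ρ := by ring
  exact e ▸ h8

/-- **Composition v4** — (M_A), (L), (D) for every admissible `v` give the crux BY NAME. [folklore] -/
theorem boundaryTransferWeak_of_coreFloor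
    (hF : ∀ v : ℝ → ℝ≥0∞, IsRepulsiveFiniteRange v → CoreFloorAlongRamp v)
    (hL : ∀ v : ℝ → ℝ≥0∞, IsRepulsiveFiniteRange v → HardWallAt v)
    (hD : ∀ v : ℝ → ℝ≥0∞, IsRepulsiveFiniteRange v → EndpointAt v) :
    Summit.AtomisticToContinuum.BoseEinsteinCondensation.Theses.BECPeriodicReduction.BoundaryTransferWeak :=
  fun v hv => cruxAt_of_coreModeTransfer (coreModeTransfer_of_coreFloor (hF v hv) (hL v hv)) (hD v hv)

/-- The same composition for the `BECGroundStateSOS` copy of the crux (lead c4's route). [folklore] -/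
theorem boundaryTransferWeak_groundStateSOS_of_coreFloor
    (hF : ∀ v : ℝ → ℝ≥0∞, IsRepulsiveFiniteRange v → CoreFloorAlongRamp v)
    (hL : ∀ v : ℝ → ℝ≥0∞, IsRepulsiveFiniteRange v → HardWallAt v)
    (hD : ∀ v : ℝ → ℝ≥0∞, IsRepulsiveFiniteRange v → EndpointAt v) :
    Summit.AtomisticToContinuum.BoseEinsteinCondensation.Theses.BECGroundStateSOS.BoundaryTransferWeak :=
  fun v hv => cruxAt_of_coreModeTransfer (coreModeTransfer_of_coreFloor (hF v hv) (hL v hv)) (hD v hv)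

/-! ## Plugging in what is landed: (T), (D) for every `v`; (G), (L) for the locally bounded class -/

/-- (T) is landed for every admissible `v` (p156370). [folklore] -/
theorem floorAt_landed (hv : IsRepulsiveFiniteRange v) : FloorAt v :=
  RimSqueeze.stub_torusCoreFloor v hv

/-- (D) is landed for every admissible `v` (p155818). [folklore] -/
theorem endpointAt_landed (hv : IsRepulsiveFiniteRange v) : EndpointAt v :=
  RimSqueeze.stub_dirichletEndpoint v hv

/-- (G) is landed for the locally bounded class (p155109). [folklore] -/
theorem gapAt_locallyBounded (hv : IsRepulsiveFiniteRange v)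
    (hlb : ∀ δ : ℝ, 0 < δ → ∃ M : ℝ≥0∞, M ≠ ⊤ ∧ ∀ r : ℝ, δ < r → v r ≤ M) : GapAt v :=
  RimSqueeze.stub_torusGap_locallyBounded v hv hlb

/-- (L) is landed for the locally bounded class (p161447). [folklore] -/
theorem hardWallAt_locallyBounded (hv : IsRepulsiveFiniteRange v)
    (hlb : ∀ δ : ℝ, 0 < δ → ∃ M : ℝ≥0∞, M ≠ ⊤ ∧ ∀ r : ℝ, δ < r → v r ≤ M) : HardWallAt v :=
  RimSqueeze.stub_hardWallLimit_locallyBounded v hv hlb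

/-- **For locally bounded admissible `v`, (M_A) alone implies the mode-pinned transfer (CMT)** —
landed glue only. [folklore] -/
theorem coreModeTransfer_of_coreFloorAlongRamp_locallyBounded (hv : IsRepulsiveFiniteRange v)
    (hlb : ∀ δ : ℝ, 0 < δ → ∃ M : ℝ≥0∞, M ≠ ⊤ ∧ ∀ r : ℝ, δ < r → v r ≤ M)
    (hF : CoreFloorAlongRamp v) : CoreModeTransfer v :=
  coreModeTransfer_of_coreFloor hF (hardWallAt_locallyBounded hv hlb)

/-- **For locally bounded admissible `v`, (M_A) alone implies the crux at `v`** — landed glue only: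
the line's one open thermodynamic stub is (at least) its parent at every such `v`. [folklore] -/
theorem cruxAt_of_coreFloorAlongRamp_locallyBounded (hv : IsRepulsiveFiniteRange v)
    (hlb : ∀ δ : ℝ, 0 < δ → ∃ M : ℝ≥0∞, M ≠ ⊤ ∧ ∀ r : ℝ, δ < r → v r ≤ M)
    (hF : CoreFloorAlongRamp v) : Antecedent v → Consequent v :=
  cruxAt_of_coreModeTransfer (coreModeTransfer_of_coreFloorAlongRamp_locallyBounded hv hlb hF)
    (endpointAt_landed hv)

/-- **For locally bounded admissible `v`, the registered (M) alone implies the crux at `v`** (through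
the landed (G), (T), (L), (D)). [folklore] -/
theorem cruxAt_of_monotoneAt_locallyBounded (hv : IsRepulsiveFiniteRange v)
    (hlb : ∀ δ : ℝ, 0 < δ → ∃ M : ℝ≥0∞, M ≠ ⊤ ∧ ∀ r : ℝ, δ < r → v r ≤ M)
    (hM : MonotoneAt v) : Antecedent v → Consequent v :=
  cruxAt_of_coreFloorAlongRamp_locallyBounded hv hlb
    (coreFloorAlongRamp_of_stubs hv (gapAt_locallyBounded hv hlb) (floorAt_landed hv) hM)

/-- **(CMT) pins the mode**: it yields not just `B(v)` but the explicit statement that, at every small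
density, the normalised indicator of the middle-half cube carries `≥ (c/2)·N` particles in every Dirichlet
near-minimiser of the cube of side `sideLength (8ρ') N` — here recorded in the currency the endpoint stub
consumes (`coreOcc v ⊤`), from which (D) extracts `condensateNumber ≥ (c/2) N`. [folklore] -/
theorem coreModeTransfer_iff (v : ℝ → ℝ≥0∞) :
    CoreModeTransfer v ↔ (Antecedent v → ∃ ρ₁ : ℝ, 0 < ρ₁ ∧ ∀ ρ' : ℝ, 0 < ρ' → ρ' < ρ₁ →
      ∃ c : ℝ, 0 < c ∧ ∀ᶠ N : ℕ in atTop, ENNReal.ofReal (c * N) ≤ coreOcc v ⊤ N ρ') :=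
  Iff.rfl

end Summit.AtomisticToContinuum.BoseEinsteinCondensation.RimSqueeze.Audit

end
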